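import Summits.CriticalPhenomena.PercolationContinuityZ3.Theorems.Transplant.FKConnectivityAllQAntipodalMajSplitSeries
import Summits.CriticalPhenomena.PercolationContinuityZ3.Theorems.Transplant.FKConnectivityAllQAntipodalMajSplitParallel
import Summits.CriticalPhenomena.PercolationContinuityZ3.Theorems.Transplant.FKConnectivityAllQAntipodalOrAttInputs
import Summits.CriticalPhenomena.PercolationContinuityZ3.Theorems.Transplant.FKConnectivityAllQAntipodalOrAttPlus
import Summits.CriticalPhenomena.PercolationContinuityZ3.Theorems.Transplant.FKConnectivityAllQAntipodalQfree
import Summits.CriticalPhenomena.PercolationContinuityZ3.Theorems.Transplant.FKConnectivityAllQAntipodalMinorDefs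
import HarnessLib

/-!
# Connectivity correlation inequalities for `φ_{w,q}`, every `q > 0` — file 48d: the `q`-free `maj₃` inequality at a SEPARATING junction —
# every cell, every antitone level weight (partial result towards the last open level-3 type of Conjecture `C_∞⁺`)

Support file (`--supports stmt-CriticalPhenomena-4575`), FK sub-lane `prim-bschramm-fk-2` (gen 22); builds on p205010 (kernel theorem,
internal audit signed; external expert review pending).  No definitions, no named facts, no sorries; standard axioms.

* `FK.apPsiCW_maj3Ind_eq` — bridge: the weighted antipodal form of `maj₃(x,y,z)` in the cell `(N ∪ {x,y,z}, C)` is `2·M`,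
  `M = D(yzC|C) + D(zC|yC) + D(yC|zC) − D(C|yzC)` (root `x`).
* **`FK.apPsiCW_maj3_nonpos_of_series_split`**, **`FK.apPsiCW_maj3_nonpos_of_parallel_split`** — if `H ∖ x` (`x = st`) is the series
  composition `E₁(s,m)·E₂(m,t)` resp. the parallel composition `E₁ ∥ E₂` with `y ∈ E₁`, `z ∈ E₂`, then for every cell, every antitone `w` and
  every increasing `g` off `{x,y,z}` the weighted antipodal form of `maj₃` against `g` is `≤ 0` — i.e. `Z_H(z,q)² Cov_{φ_{z,q}}(maj₃, g) ∈
  (q−1)·ℝ≥0[z,q]` for these hosts (partial sums by level and the `q`-form: `…_levels_le_…`, `…_of_levels`).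
  The general `maj₃` (one-sided junctions) is OPEN: there the far side is not signed (memo FROM-fk-2-g22-ORATT §3–§6).
[cite: Grimmett2006, §1.4 eq. (1.20) (p. 15); §3.8 Thm. (3.90) (pp. 61–62); §3.9 (pp. 63–64)] [cite: Wagner2006, Thm. 5.8(d), §5.3]
-/

noncomputable section

namespace Summit.CriticalPhenomena.PercolationContinuityZ3.Theorems

namespace FK

open SimpleGraph Literature.Probability.LatticeModels Literature.Probability.Percolation
open scoped Classical

variable {V : Type*} [Fintype V]

section MajSplitPlus

omit [Fintype V] in
/-- **Bridge.**  For distinct `x, y, z ∉ N ∪ C` and `g` not reading `x, y, z`, the weighted antipodal form of `f = maj₃(x,y,z)` (at least two of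
the three edges) in the cell `(N ∪ {x,y,z}, C)` is `2·M = 2[(yzC | C) + (zC | yC) + (yC | zC) − (C | yzC)]` (two-sided drifts, root `x`).
[cite: Grimmett2006, §1.4 eq. (1.20) (p. 15); §3.8 (pp. 61–62)] -/
theorem apPsiCW_maj3Ind_eq (w : ℕ → ℝ) {N C : Finset (Sym2 V)} {x y z : Sym2 V}
    (hxN : x ∉ N) (hyN : y ∉ N) (hzN : z ∉ N) (hxC : x ∉ C) (hyC : y ∉ C) (hzC : z ∉ C)
    (hxy : x ≠ y) (hxz : x ≠ z) (hyz : y ≠ z)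
    {g : Finset (Sym2 V) → ℝ} (hg : ∀ A U : Finset (Sym2 V), U ⊆ ({x, y, z} : Finset (Sym2 V)) → g (A ∪ U) = g A) :
    ∑ γ ∈ (N ∪ {x, y, z}).powerset, w (apExpC (N ∪ {x, y, z}) C γ) *
        ((((fun X : Finset (Sym2 V) => if (x ∈ X ∧ y ∈ X) ∨ (x ∈ X ∧ z ∈ X) ∨ (y ∈ X ∧ z ∈ X) then (1 : ℝ) else 0) (γ ∪ C)) -
            ((fun X : Finset (Sym2 V) => if (x ∈ X ∧ y ∈ X) ∨ (x ∈ X ∧ z ∈ X) ∨ (y ∈ X ∧ z ∈ X) then (1 : ℝ) else 0) ((N ∪ {x, y, z}) \ γ ∪ C))) *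
          (g (γ ∪ C) - g ((N ∪ {x, y, z}) \ γ ∪ C))) =
      2 * (∑ γ ∈ N.powerset,
          (w (clusterCount (↑(insert x (γ ∪ insert y (insert z C))) : BondConfig V) ∅ +
                clusterCount (↑(N \ γ ∪ C) : BondConfig V) ∅) -
            w (clusterCount (↑(insert x (N \ γ ∪ insert y (insert z C))) : BondConfig V) ∅ +
                clusterCount (↑(γ ∪ C) : BondConfig V) ∅)) * g (γ ∪ C) +
        ∑ γ ∈ N.powerset,
          (w (clusterCount (↑(insert x (γ ∪ insert z C)) : BondConfig V) ∅ +
                clusterCount (↑(N \ γ ∪ insert y C) : BondConfig V) ∅) -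
            w (clusterCount (↑(insert x (N \ γ ∪ insert z C)) : BondConfig V) ∅ +
                clusterCount (↑(γ ∪ insert y C) : BondConfig V) ∅)) * g (γ ∪ C) +
        ∑ γ ∈ N.powerset,
          (w (clusterCount (↑(insert x (γ ∪ insert y C)) : BondConfig V) ∅ +
                clusterCount (↑(N \ γ ∪ insert z C) : BondConfig V) ∅) -
            w (clusterCount (↑(insert x (N \ γ ∪ insert y C)) : BondConfig V) ∅ +
                clusterCount (↑(γ ∪ insert z C) : BondConfig V) ∅)) * g (γ ∪ C) -
        ∑ γ ∈ N.powerset,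
          (w (clusterCount (↑(insert x (γ ∪ C)) : BondConfig V) ∅ +
                clusterCount (↑(N \ γ ∪ insert y (insert z C)) : BondConfig V) ∅) -
            w (clusterCount (↑(insert x (N \ γ ∪ C)) : BondConfig V) ∅ +
                clusterCount (↑(γ ∪ insert y (insert z C)) : BondConfig V) ∅)) * g (γ ∪ C)) := by
  rw [apPsiCW_half_eq w (N ∪ {x, y, z}) C (fun X : Finset (Sym2 V) => if (x ∈ X ∧ y ∈ X) ∨ (x ∈ X ∧ z ∈ X) ∨ (y ∈ X ∧ z ∈ X) then (1 : ℝ) else 0) g]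
  congr 1
  -- the cell's edge set as an insert-chain over `N`
  have hset : N ∪ {x, y, z} = insert x (insert y (insert z N)) := by
    rw [Finset.union_comm, Finset.insert_union, Finset.insert_union, Finset.singleton_union]
  rw [hset]
  have hxN' : x ∉ insert y (insert z N) := by
    rw [Finset.mem_insert, Finset.mem_insert, not_or, not_or]; exact ⟨hxy, hxz, hxN⟩
  have hyN' : y ∉ insert z N := by rw [Finset.mem_insert, not_or]; exact ⟨hyz, hyN⟩
  rw [Finset.sum_powerset_insert hxN', Finset.sum_powerset_insert hyN', Finset.sum_powerset_insert hyN',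
    Finset.sum_powerset_insert hzN, Finset.sum_powerset_insert hzN, Finset.sum_powerset_insert hzN, Finset.sum_powerset_insert hzN]
  -- `g` ignores `x, y, z`
  have hgx : ∀ A : Finset (Sym2 V), g (insert x A) = g A := fun A => by
    rw [Finset.insert_eq, Finset.union_comm]; exact hg A {x} (by simp)
  have hgy : ∀ A : Finset (Sym2 V), g (insert y A) = g A := fun A => by
    rw [Finset.insert_eq, Finset.union_comm]; exact hg A {y} (by simp)
  have hgz : ∀ A : Finset (Sym2 V), g (insert z A) = g A := fun A => by
    rw [Finset.insert_eq, Finset.union_comm]; exact hg A {z} (by simp)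
  simp only [← Finset.sum_add_distrib, ← Finset.sum_sub_distrib]
  refine Finset.sum_congr rfl fun β hβ => ?_
  rw [Finset.mem_powerset] at hβ
  have hxβ : x ∉ β := fun hh => hxN (hβ hh)
  have hyβ : y ∉ β := fun hh => hyN (hβ hh)
  have hzβ : z ∉ β := fun hh => hzN (hβ hh)
  simp only [apExpC, Finset.insert_sdiff_of_mem, Finset.insert_sdiff_of_notMem, Finset.sdiff_insert_of_notMem, Finset.mem_insert,
    Finset.mem_union, Finset.mem_sdiff, hxβ, hyβ, hzβ, hxN, hyN, hzN, hxC, hyC, hzC, hxy, hxz, hyz, hxy.symm, hxz.symm, hyz.symm,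
    Finset.insert_union, Finset.union_insert, hgx, hgy, hgz, or_true, or_false, and_true, and_false,
    if_true, if_false, not_false_iff, or_self, sub_zero, zero_sub, mul_one]
  ring

/-- **THEOREM (`q`-free `maj₃` at a separating SERIES junction — every cell, every antitone weight).**  `H ∖ x = E₁(s,m) · E₂(m,t)`
(`x = st ∉ H ∖ x`), `y ∈ E₁`, `z ∈ E₂`, `N, C` disjoint (free / contracted) not containing `y, z`, `w` antitone, `g` increasing off `x, y, z` ⟹ the
weighted antipodal form of `maj₃(x,y,z)` against `g` in the cell `(N ∪ {x,y,z}, C)` is `≤ 0`.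
[cite: Grimmett2006, §3.8 Thm. (3.90) (pp. 61–62); §3.9 (pp. 63–64)] [cite: Wagner2006, Thm. 5.8(d), §5.3] -/
theorem apPsiCW_maj3_nonpos_of_series_split {E₁ E₂ : Finset (Sym2 V)} {s m t : V}
    (h₁ : IsTTSP E₁ s m) (h₂ : IsTTSP E₂ m t) (hd : Disjoint E₁ E₂) (hV : ∀ v : V, (∃ e ∈ E₁, v ∈ e) → (∃ e ∈ E₂, v ∈ e) → v = m)
    (hs' : ∀ e ∈ E₂, s ∉ e) (ht' : ∀ e ∈ E₁, t ∉ e) (hst : s(s, t) ∉ E₁ ∪ E₂)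
    {N C : Finset (Sym2 V)} {y z : Sym2 V} (hN : N ⊆ E₁ ∪ E₂) (hC : C ⊆ E₁ ∪ E₂)
    (hy : y ∈ E₁) (hz : z ∈ E₂) (hyN : y ∉ N) (hzN : z ∉ N) (hyC : y ∉ C) (hzC : z ∉ C) (hNC : Disjoint N C)
    {w : ℕ → ℝ} (hw : ∀ n : ℕ, w (n + 1) ≤ w n)
    {g : Finset (Sym2 V) → ℝ} (hg : ∀ A U : Finset (Sym2 V), U ⊆ ({s(s, t), y, z} : Finset (Sym2 V)) → g (A ∪ U) = g A)
    (hmono : ∀ ⦃X Y : Finset (Sym2 V)⦄, X ⊆ Y → g X ≤ g Y) :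
    ∑ γ ∈ (N ∪ {s(s, t), y, z}).powerset, w (apExpC (N ∪ {s(s, t), y, z}) C γ) *
        ((((fun X : Finset (Sym2 V) => if (s(s, t) ∈ X ∧ y ∈ X) ∨ (s(s, t) ∈ X ∧ z ∈ X) ∨ (y ∈ X ∧ z ∈ X) then (1 : ℝ) else 0) (γ ∪ C)) -
            ((fun X : Finset (Sym2 V) => if (s(s, t) ∈ X ∧ y ∈ X) ∨ (s(s, t) ∈ X ∧ z ∈ X) ∨ (y ∈ X ∧ z ∈ X) then (1 : ℝ) else 0) ((N ∪ {s(s, t), y, z}) \ γ ∪ C))) *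
          (g (γ ∪ C) - g ((N ∪ {s(s, t), y, z}) \ γ ∪ C))) ≤ 0 := by
  have hyz : y ≠ z := fun hh => Finset.disjoint_left.1 hd hy (hh ▸ hz)
  have hxN : s(s, t) ∉ N := fun hh => hst (hN hh)
  have hxC : s(s, t) ∉ C := fun hh => hst (hC hh)
  have hxy : s(s, t) ≠ y := fun hh => hst (Finset.mem_union_left _ (hh ▸ hy))
  have hxz : s(s, t) ≠ z := fun hh => hst (Finset.mem_union_right _ (hh ▸ hz))
  rw [apPsiCW_maj3Ind_eq w hxN hyN hzN hxC hyC hzC hxy hxz hyz hg]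
  have hNeq : N = N ∩ E₁ ∪ N ∩ E₂ := by rw [← Finset.inter_union_distrib_left, Finset.inter_eq_left.2 hN]
  have hCeq : C = C ∩ E₁ ∪ C ∩ E₂ := by rw [← Finset.inter_union_distrib_left, Finset.inter_eq_left.2 hC]
  have hyN₁ : y ∉ N ∩ E₁ := fun hh => hyN (Finset.mem_of_mem_inter_left hh)
  have hzN₂ : z ∉ N ∩ E₂ := fun hh => hzN (Finset.mem_of_mem_inter_left hh)
  have hyC₁ : y ∉ C ∩ E₁ := fun hh => hyC (Finset.mem_of_mem_inter_left hh)
  have hzC₂ : z ∉ C ∩ E₂ := fun hh => hzC (Finset.mem_of_mem_inter_left hh)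
  have hNC₁ : Disjoint (N ∩ E₁) (C ∩ E₁) :=
    Finset.disjoint_of_subset_left Finset.inter_subset_left (Finset.disjoint_of_subset_right Finset.inter_subset_left hNC)
  have hNC₂ : Disjoint (N ∩ E₂) (C ∩ E₂) :=
    Finset.disjoint_of_subset_left Finset.inter_subset_left (Finset.disjoint_of_subset_right Finset.inter_subset_left hNC)
  have hdN : Disjoint (N ∩ E₁) (N ∩ E₂) :=
    Finset.disjoint_of_subset_left Finset.inter_subset_right (Finset.disjoint_of_subset_right Finset.inter_subset_right hd)
  set V₁ : Set V := {v | ∃ e ∈ E₁, v ∈ e} with hV₁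
  set V₂ : Set V := {v | ∃ e ∈ E₂, v ∈ e} with hV₂
  have g₁ : ∀ e ∈ (↑E₁ : Set (Sym2 V)), ∀ v ∈ e, v ∈ V₁ := fun e he v hv => ⟨e, he, hv⟩
  have g₂ : ∀ e ∈ (↑E₂ : Set (Sym2 V)), ∀ v ∈ e, v ∈ V₂ := fun e he v hv => ⟨e, he, hv⟩
  have e1 : insert y (insert z (C ∩ E₁ ∪ C ∩ E₂)) = insert y (C ∩ E₁) ∪ insert z (C ∩ E₂) := by
    rw [Finset.insert_union, Finset.union_insert]
  have e2 : insert z (C ∩ E₁ ∪ C ∩ E₂) = C ∩ E₁ ∪ insert z (C ∩ E₂) := (Finset.union_insert _ _ _).symm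
  have e3 : insert y (C ∩ E₁ ∪ C ∩ E₂) = insert y (C ∩ E₁) ∪ C ∩ E₂ := (Finset.insert_union _ _ _).symm
  rw [hNeq, hCeq, e1, e2, e3]
  refine mul_nonpos_of_nonneg_of_nonpos (by norm_num) ?_
  have gS : V₁ ∩ V₂ ⊆ ({m} : Set V) := fun v hv => hV v hv.1 hv.2
  have hsV₂ : s ∉ V₂ := fun ⟨e, he, hse⟩ => hs' e he hse
  have htV₁ : t ∉ V₁ := fun ⟨e, he, hte⟩ => ht' e he hte
  have hsm : s ≠ m := h₁.ne
  have htm : t ≠ m := h₂.ne.symm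
  have hstne : s ≠ t := by
    obtain ⟨e, he, hte⟩ := h₂.right_mem
    intro hh; exact hs' e he (hh ▸ hte)
  exact majW_series_split_nonpos g₁ g₂ gS hsV₂ htV₁ hsm htm hstne hdN Finset.inter_subset_right Finset.inter_subset_right hy hyN₁
    Finset.inter_subset_right Finset.inter_subset_right hz hzN₂ (orAtt_inU h₁ hy hyC hNC)
    (fun w' hw' h' hm' => majDiffW_nonpos_of_isTTSP h₁ hy Finset.inter_subset_right Finset.inter_subset_right hyN₁ hyC₁ hNC₁ hw' hm')
    (orAtt_inR h₁ hy hyN hNC) (orAtt_inU h₂ hz hzC hNC)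
    (fun w' hw' h' hm' => majDiffW_nonpos_of_isTTSP h₂ hz Finset.inter_subset_right Finset.inter_subset_right hzN₂ hzC₂ hNC₂ hw' hm')
    (orAtt_inR h₂ hz hzN hNC) hw (fun A B hAB _ => hmono (Finset.union_subset_union hAB le_rfl))

/-- **THEOREM (`q`-free `maj₃` at a separating PARALLEL junction — every cell, every antitone weight).**  `H ∖ x = E₁ ∥ E₂` between
`s, t` (`x = st`), `y ∈ E₁`, `z ∈ E₂`; otherwise as `FK.apPsiCW_maj3_nonpos_of_series_split`.
[cite: Grimmett2006, §3.8 Thm. (3.90) (pp. 61–62); §3.9 (pp. 63–64)] [cite: Wagner2006, Thm. 5.8(d), §5.3] -/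
theorem apPsiCW_maj3_nonpos_of_parallel_split {E₁ E₂ : Finset (Sym2 V)} {s t : V}
    (h₁ : IsTTSP E₁ s t) (h₂ : IsTTSP E₂ s t) (hd : Disjoint E₁ E₂) (hV : ∀ v : V, (∃ e ∈ E₁, v ∈ e) → (∃ e ∈ E₂, v ∈ e) → v = s ∨ v = t)
    (hst : s(s, t) ∉ E₁ ∪ E₂)
    {N C : Finset (Sym2 V)} {y z : Sym2 V} (hN : N ⊆ E₁ ∪ E₂) (hC : C ⊆ E₁ ∪ E₂)
    (hy : y ∈ E₁) (hz : z ∈ E₂) (hyN : y ∉ N) (hzN : z ∉ N) (hyC : y ∉ C) (hzC : z ∉ C) (hNC : Disjoint N C)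
    {w : ℕ → ℝ} (hw : ∀ n : ℕ, w (n + 1) ≤ w n)
    {g : Finset (Sym2 V) → ℝ} (hg : ∀ A U : Finset (Sym2 V), U ⊆ ({s(s, t), y, z} : Finset (Sym2 V)) → g (A ∪ U) = g A)
    (hmono : ∀ ⦃X Y : Finset (Sym2 V)⦄, X ⊆ Y → g X ≤ g Y) :
    ∑ γ ∈ (N ∪ {s(s, t), y, z}).powerset, w (apExpC (N ∪ {s(s, t), y, z}) C γ) *
        ((((fun X : Finset (Sym2 V) => if (s(s, t) ∈ X ∧ y ∈ X) ∨ (s(s, t) ∈ X ∧ z ∈ X) ∨ (y ∈ X ∧ z ∈ X) then (1 : ℝ) else 0) (γ ∪ C)) -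
            ((fun X : Finset (Sym2 V) => if (s(s, t) ∈ X ∧ y ∈ X) ∨ (s(s, t) ∈ X ∧ z ∈ X) ∨ (y ∈ X ∧ z ∈ X) then (1 : ℝ) else 0) ((N ∪ {s(s, t), y, z}) \ γ ∪ C))) *
          (g (γ ∪ C) - g ((N ∪ {s(s, t), y, z}) \ γ ∪ C))) ≤ 0 := by
  have hyz : y ≠ z := fun hh => Finset.disjoint_left.1 hd hy (hh ▸ hz)
  have hxN : s(s, t) ∉ N := fun hh => hst (hN hh)
  have hxC : s(s, t) ∉ C := fun hh => hst (hC hh)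
  have hxy : s(s, t) ≠ y := fun hh => hst (Finset.mem_union_left _ (hh ▸ hy))
  have hxz : s(s, t) ≠ z := fun hh => hst (Finset.mem_union_right _ (hh ▸ hz))
  rw [apPsiCW_maj3Ind_eq w hxN hyN hzN hxC hyC hzC hxy hxz hyz hg]
  have hNeq : N = N ∩ E₁ ∪ N ∩ E₂ := by rw [← Finset.inter_union_distrib_left, Finset.inter_eq_left.2 hN]
  have hCeq : C = C ∩ E₁ ∪ C ∩ E₂ := by rw [← Finset.inter_union_distrib_left, Finset.inter_eq_left.2 hC]
  have hyN₁ : y ∉ N ∩ E₁ := fun hh => hyN (Finset.mem_of_mem_inter_left hh)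
  have hzN₂ : z ∉ N ∩ E₂ := fun hh => hzN (Finset.mem_of_mem_inter_left hh)
  have hyC₁ : y ∉ C ∩ E₁ := fun hh => hyC (Finset.mem_of_mem_inter_left hh)
  have hzC₂ : z ∉ C ∩ E₂ := fun hh => hzC (Finset.mem_of_mem_inter_left hh)
  have hNC₁ : Disjoint (N ∩ E₁) (C ∩ E₁) :=
    Finset.disjoint_of_subset_left Finset.inter_subset_left (Finset.disjoint_of_subset_right Finset.inter_subset_left hNC)
  have hNC₂ : Disjoint (N ∩ E₂) (C ∩ E₂) :=
    Finset.disjoint_of_subset_left Finset.inter_subset_left (Finset.disjoint_of_subset_right Finset.inter_subset_left hNC)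
  have hdN : Disjoint (N ∩ E₁) (N ∩ E₂) :=
    Finset.disjoint_of_subset_left Finset.inter_subset_right (Finset.disjoint_of_subset_right Finset.inter_subset_right hd)
  set V₁ : Set V := {v | ∃ e ∈ E₁, v ∈ e} with hV₁
  set V₂ : Set V := {v | ∃ e ∈ E₂, v ∈ e} with hV₂
  have g₁ : ∀ e ∈ (↑E₁ : Set (Sym2 V)), ∀ v ∈ e, v ∈ V₁ := fun e he v hv => ⟨e, he, hv⟩
  have g₂ : ∀ e ∈ (↑E₂ : Set (Sym2 V)), ∀ v ∈ e, v ∈ V₂ := fun e he v hv => ⟨e, he, hv⟩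
  have e1 : insert y (insert z (C ∩ E₁ ∪ C ∩ E₂)) = insert y (C ∩ E₁) ∪ insert z (C ∩ E₂) := by
    rw [Finset.insert_union, Finset.union_insert]
  have e2 : insert z (C ∩ E₁ ∪ C ∩ E₂) = C ∩ E₁ ∪ insert z (C ∩ E₂) := (Finset.union_insert _ _ _).symm
  have e3 : insert y (C ∩ E₁ ∪ C ∩ E₂) = insert y (C ∩ E₁) ∪ C ∩ E₂ := (Finset.insert_union _ _ _).symm
  rw [hNeq, hCeq, e1, e2, e3]
  refine mul_nonpos_of_nonneg_of_nonpos (by norm_num) ?_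
  have gS : V₁ ∩ V₂ ⊆ ({s, t} : Set V) := by
    intro v hv
    rcases hV v hv.1 hv.2 with h' | h'
    · exact Or.inl h'
    · exact Or.inr h'
  have hstne : s ≠ t := h₁.ne
  have hst₁ : s(s, t) ∉ E₁ := fun hh => hst (Finset.mem_union_left _ hh)
  have hst₂ : s(s, t) ∉ E₂ := fun hh => hst (Finset.mem_union_right _ hh)
  exact majW_parallel_split_nonpos g₁ g₂ gS hstne hdN Finset.inter_subset_right Finset.inter_subset_right hy hyN₁
    Finset.inter_subset_right Finset.inter_subset_right hz hzN₂ (orAtt_inU h₁ hy hyC hNC)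
    (fun w' hw' h' hm' => majDiffW_nonpos_of_isTTSP h₁ hy Finset.inter_subset_right Finset.inter_subset_right hyN₁ hyC₁ hNC₁ hw' hm')
    (orAtt_inK hst₁ h₁ hy hyN hNC) (orAtt_inU h₂ hz hzC hNC)
    (fun w' hw' h' hm' => majDiffW_nonpos_of_isTTSP h₂ hz Finset.inter_subset_right Finset.inter_subset_right hzN₂ hzC₂ hNC₂ hw' hm')
    (orAtt_inK hst₂ h₂ hz hzN hNC) hw (fun A B hAB _ => hmono (Finset.union_subset_union hAB le_rfl))

/-- **COROLLARY (`maj₃` at a separating series junction, partial sums by cluster level): every coefficient — in the edge odds AND in `q` — of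
`Z_H(z,q)² Cov_{φ_{z,q}}(maj₃, g)/(q−1)` is nonnegative for these hosts.** [cite: Grimmett2006, §3.8 Thm. (3.90) (pp. 61–62)] [cite: Wagner2006, Thm. 5.8(d), §5.3] -/
theorem apPsiC_levels_le_maj3_nonpos_of_series_split {E₁ E₂ : Finset (Sym2 V)} {s m t : V}
    (h₁ : IsTTSP E₁ s m) (h₂ : IsTTSP E₂ m t) (hd : Disjoint E₁ E₂) (hV : ∀ v : V, (∃ e ∈ E₁, v ∈ e) → (∃ e ∈ E₂, v ∈ e) → v = m)
    (hs' : ∀ e ∈ E₂, s ∉ e) (ht' : ∀ e ∈ E₁, t ∉ e) (hst : s(s, t) ∉ E₁ ∪ E₂)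
    {N C : Finset (Sym2 V)} {y z : Sym2 V} (hN : N ⊆ E₁ ∪ E₂) (hC : C ⊆ E₁ ∪ E₂)
    (hy : y ∈ E₁) (hz : z ∈ E₂) (hyN : y ∉ N) (hzN : z ∉ N) (hyC : y ∉ C) (hzC : z ∉ C) (hNC : Disjoint N C) (J : ℕ)
    {g : Finset (Sym2 V) → ℝ} (hg : ∀ A U : Finset (Sym2 V), U ⊆ ({s(s, t), y, z} : Finset (Sym2 V)) → g (A ∪ U) = g A)
    (hmono : ∀ ⦃X Y : Finset (Sym2 V)⦄, X ⊆ Y → g X ≤ g Y) :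
    ∑ γ ∈ (N ∪ {s(s, t), y, z}).powerset with apExpC (N ∪ {s(s, t), y, z}) C γ ≤ J,
        ((((fun X : Finset (Sym2 V) => if (s(s, t) ∈ X ∧ y ∈ X) ∨ (s(s, t) ∈ X ∧ z ∈ X) ∨ (y ∈ X ∧ z ∈ X) then (1 : ℝ) else 0) (γ ∪ C)) -
            ((fun X : Finset (Sym2 V) => if (s(s, t) ∈ X ∧ y ∈ X) ∨ (s(s, t) ∈ X ∧ z ∈ X) ∨ (y ∈ X ∧ z ∈ X) then (1 : ℝ) else 0) ((N ∪ {s(s, t), y, z}) \ γ ∪ C))) *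
          (g (γ ∪ C) - g ((N ∪ {s(s, t), y, z}) \ γ ∪ C))) ≤ 0 := by
  have key := apPsiCW_maj3_nonpos_of_series_split h₁ h₂ hd hV hs' ht' hst hN hC hy hz hyN hzN hyC hzC hNC (w := fun n => if n ≤ J then (1 : ℝ) else 0)
    (fun n => by
      split_ifs with h1 h2 h2
      · exact le_rfl
      · exact absurd ((Nat.le_succ n).trans h1) h2
      · exact zero_le_one
      · exact le_rfl) hg hmono
  rw [Finset.sum_filter]
  refine le_of_eq_of_le (Finset.sum_congr rfl fun γ _ => ?_) key
  split_ifs <;> ring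

/-- **COROLLARY (`maj₃` at a separating series junction for all `0 ≤ q ≤ 1`, every cell, via the Abel bridge of `…Qfree`).**
[cite: Grimmett2006, §3.8 Thm. (3.90) (pp. 61–62); §3.9 (pp. 63–64)] [cite: Wagner2006, Thm. 5.8(d), §5.3] -/
theorem apPsiC_maj3_nonpos_of_series_split_of_levels {q : ℝ} (hq0 : 0 ≤ q) (hq1 : q ≤ 1) {E₁ E₂ : Finset (Sym2 V)} {s m t : V}
    (h₁ : IsTTSP E₁ s m) (h₂ : IsTTSP E₂ m t) (hd : Disjoint E₁ E₂) (hV : ∀ v : V, (∃ e ∈ E₁, v ∈ e) → (∃ e ∈ E₂, v ∈ e) → v = m)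
    (hs' : ∀ e ∈ E₂, s ∉ e) (ht' : ∀ e ∈ E₁, t ∉ e) (hst : s(s, t) ∉ E₁ ∪ E₂)
    {N C : Finset (Sym2 V)} {y z : Sym2 V} (hN : N ⊆ E₁ ∪ E₂) (hC : C ⊆ E₁ ∪ E₂)
    (hy : y ∈ E₁) (hz : z ∈ E₂) (hyN : y ∉ N) (hzN : z ∉ N) (hyC : y ∉ C) (hzC : z ∉ C) (hNC : Disjoint N C)
    {g : Finset (Sym2 V) → ℝ} (hg : ∀ A U : Finset (Sym2 V), U ⊆ ({s(s, t), y, z} : Finset (Sym2 V)) → g (A ∪ U) = g A)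
    (hmono : ∀ ⦃X Y : Finset (Sym2 V)⦄, X ⊆ Y → g X ≤ g Y) :
    apPsiC q (N ∪ {s(s, t), y, z}) C (fun X => if (s(s, t) ∈ X ∧ y ∈ X) ∨ (s(s, t) ∈ X ∧ z ∈ X) ∨ (y ∈ X ∧ z ∈ X) then 1 else 0) g ≤ 0 :=
  sum_pow_mul_nonpos_of_levels_le (N ∪ {s(s, t), y, z}).powerset (apExpC (N ∪ {s(s, t), y, z}) C)
    (fun γ => (((fun X : Finset (Sym2 V) => if (s(s, t) ∈ X ∧ y ∈ X) ∨ (s(s, t) ∈ X ∧ z ∈ X) ∨ (y ∈ X ∧ z ∈ X) then (1 : ℝ) else 0) (γ ∪ C)) -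
      ((fun X : Finset (Sym2 V) => if (s(s, t) ∈ X ∧ y ∈ X) ∨ (s(s, t) ∈ X ∧ z ∈ X) ∨ (y ∈ X ∧ z ∈ X) then (1 : ℝ) else 0) ((N ∪ {s(s, t), y, z}) \ γ ∪ C))) *
      (g (γ ∪ C) - g ((N ∪ {s(s, t), y, z}) \ γ ∪ C)))
    hq0 hq1 fun J => apPsiC_levels_le_maj3_nonpos_of_series_split h₁ h₂ hd hV hs' ht' hst hN hC hy hz hyN hzN hyC hzC hNC J hg hmono

/-- **COROLLARY (`maj₃` at a separating parallel junction, partial sums by cluster level): every coefficient — in the edge odds AND in `q` — of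
`Z_H(z,q)² Cov_{φ_{z,q}}(maj₃, g)/(q−1)` is nonnegative for these hosts.** [cite: Grimmett2006, §3.8 Thm. (3.90) (pp. 61–62)] [cite: Wagner2006, Thm. 5.8(d), §5.3] -/
theorem apPsiC_levels_le_maj3_nonpos_of_parallel_split {E₁ E₂ : Finset (Sym2 V)} {s t : V}
    (h₁ : IsTTSP E₁ s t) (h₂ : IsTTSP E₂ s t) (hd : Disjoint E₁ E₂) (hV : ∀ v : V, (∃ e ∈ E₁, v ∈ e) → (∃ e ∈ E₂, v ∈ e) → v = s ∨ v = t)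
    (hst : s(s, t) ∉ E₁ ∪ E₂)
    {N C : Finset (Sym2 V)} {y z : Sym2 V} (hN : N ⊆ E₁ ∪ E₂) (hC : C ⊆ E₁ ∪ E₂)
    (hy : y ∈ E₁) (hz : z ∈ E₂) (hyN : y ∉ N) (hzN : z ∉ N) (hyC : y ∉ C) (hzC : z ∉ C) (hNC : Disjoint N C) (J : ℕ)
    {g : Finset (Sym2 V) → ℝ} (hg : ∀ A U : Finset (Sym2 V), U ⊆ ({s(s, t), y, z} : Finset (Sym2 V)) → g (A ∪ U) = g A)
    (hmono : ∀ ⦃X Y : Finset (Sym2 V)⦄, X ⊆ Y → g X ≤ g Y) :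
    ∑ γ ∈ (N ∪ {s(s, t), y, z}).powerset with apExpC (N ∪ {s(s, t), y, z}) C γ ≤ J,
        ((((fun X : Finset (Sym2 V) => if (s(s, t) ∈ X ∧ y ∈ X) ∨ (s(s, t) ∈ X ∧ z ∈ X) ∨ (y ∈ X ∧ z ∈ X) then (1 : ℝ) else 0) (γ ∪ C)) -
            ((fun X : Finset (Sym2 V) => if (s(s, t) ∈ X ∧ y ∈ X) ∨ (s(s, t) ∈ X ∧ z ∈ X) ∨ (y ∈ X ∧ z ∈ X) then (1 : ℝ) else 0) ((N ∪ {s(s, t), y, z}) \ γ ∪ C))) *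
          (g (γ ∪ C) - g ((N ∪ {s(s, t), y, z}) \ γ ∪ C))) ≤ 0 := by
  have key := apPsiCW_maj3_nonpos_of_parallel_split h₁ h₂ hd hV hst hN hC hy hz hyN hzN hyC hzC hNC (w := fun n => if n ≤ J then (1 : ℝ) else 0)
    (fun n => by
      split_ifs with h1 h2 h2
      · exact le_rfl
      · exact absurd ((Nat.le_succ n).trans h1) h2
      · exact zero_le_one
      · exact le_rfl) hg hmono
  rw [Finset.sum_filter]
  refine le_of_eq_of_le (Finset.sum_congr rfl fun γ _ => ?_) key
  split_ifs <;> ring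

/-- **COROLLARY (`maj₃` at a separating parallel junction for all `0 ≤ q ≤ 1`, every cell, via the Abel bridge of `…Qfree`).**
[cite: Grimmett2006, §3.8 Thm. (3.90) (pp. 61–62); §3.9 (pp. 63–64)] [cite: Wagner2006, Thm. 5.8(d), §5.3] -/
theorem apPsiC_maj3_nonpos_of_parallel_split_of_levels {q : ℝ} (hq0 : 0 ≤ q) (hq1 : q ≤ 1) {E₁ E₂ : Finset (Sym2 V)} {s t : V}
    (h₁ : IsTTSP E₁ s t) (h₂ : IsTTSP E₂ s t) (hd : Disjoint E₁ E₂) (hV : ∀ v : V, (∃ e ∈ E₁, v ∈ e) → (∃ e ∈ E₂, v ∈ e) → v = s ∨ v = t)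
    (hst : s(s, t) ∉ E₁ ∪ E₂)
    {N C : Finset (Sym2 V)} {y z : Sym2 V} (hN : N ⊆ E₁ ∪ E₂) (hC : C ⊆ E₁ ∪ E₂)
    (hy : y ∈ E₁) (hz : z ∈ E₂) (hyN : y ∉ N) (hzN : z ∉ N) (hyC : y ∉ C) (hzC : z ∉ C) (hNC : Disjoint N C)
    {g : Finset (Sym2 V) → ℝ} (hg : ∀ A U : Finset (Sym2 V), U ⊆ ({s(s, t), y, z} : Finset (Sym2 V)) → g (A ∪ U) = g A)
    (hmono : ∀ ⦃X Y : Finset (Sym2 V)⦄, X ⊆ Y → g X ≤ g Y) :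
    apPsiC q (N ∪ {s(s, t), y, z}) C (fun X => if (s(s, t) ∈ X ∧ y ∈ X) ∨ (s(s, t) ∈ X ∧ z ∈ X) ∨ (y ∈ X ∧ z ∈ X) then 1 else 0) g ≤ 0 :=
  sum_pow_mul_nonpos_of_levels_le (N ∪ {s(s, t), y, z}).powerset (apExpC (N ∪ {s(s, t), y, z}) C)
    (fun γ => (((fun X : Finset (Sym2 V) => if (s(s, t) ∈ X ∧ y ∈ X) ∨ (s(s, t) ∈ X ∧ z ∈ X) ∨ (y ∈ X ∧ z ∈ X) then (1 : ℝ) else 0) (γ ∪ C)) -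
      ((fun X : Finset (Sym2 V) => if (s(s, t) ∈ X ∧ y ∈ X) ∨ (s(s, t) ∈ X ∧ z ∈ X) ∨ (y ∈ X ∧ z ∈ X) then (1 : ℝ) else 0) ((N ∪ {s(s, t), y, z}) \ γ ∪ C))) *
      (g (γ ∪ C) - g ((N ∪ {s(s, t), y, z}) \ γ ∪ C)))
    hq0 hq1 fun J => apPsiC_levels_le_maj3_nonpos_of_parallel_split h₁ h₂ hd hV hst hN hC hy hz hyN hzN hyC hzC hNC J hg hmono

end MajSplitPlus

end FK

end Summit.CriticalPhenomena.PercolationContinuityZ3.Theorems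

end
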